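import Mathlib.AlgebraicGeometry.Morphisms.Proper
import Mathlib.AlgebraicGeometry.Fiber
import Mathlib.AlgebraicGeometry.FunctionField
import HarnessLib

/-!
# Pulling back functions along a morphism through the generic points — auxiliary lemmas

General lemmas on sections of the structure sheaf that enter the proof of The Stacks Project,
Tag 0AY8 (More on Morphisms, Lemma 37.53.6: a proper `f : X → S` towards a normal integral `S`,
with `X` reduced, the generic points of the irreducible components of `X` over the generic point
`ξ`, and `H⁰(X_ξ, 𝒪) = κ(ξ)`, has `f_* 𝒪_X = 𝒪_S` and geometrically connected fibres):

* `app_injective_of_genericPoints_subset_range` — if `X` is reduced and `g : Y → X` hits every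
  generic point of an irreducible component of `X`, then `g^* : 𝒪_X(V) → 𝒪_Y(g⁻¹V)` is injective
  for every open `V` ("`f_* 𝒪_X` is torsion free" in the printed proof of Tag 0AY8, applied to
  `Y = X_ξ`): a section killed by `g^*` has `g⁻¹(D(b)) = ∅`, so the open `D(b)` contains no
  generic point; generic points are dense (Mathlib `genericPoints.closure`), so `D(b) = ∅` and
  `b = 0` (Mathlib `basicOpen_eq_bot_iff`);
* `residue_genericPoint_bijective` — `𝒪_{S,ξ} → κ(ξ)` is bijective for `S` integral;
* `fromSpecResidueField_preimage_eq_top`, `le_iSup_affineOpens_le`, `app_presheafMap_apply`,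
  `presheaf_map_congr_hom` — bookkeeping on opens and restriction maps.

Tag 0AY8 itself — `f_* 𝒪_X = 𝒪_S` and `S' = S` unconditionally for `f` universally closed, and
both conclusions from Stein factorisation (Tag 03H2) — is
`Literature/AlgebraicGeometry/Morphisms/SteinFactorizationProofs.lean`
(`TowardsNormal.bijective_app`, `TowardsNormal.isIso_app`, `TowardsNormal.isIso_fromNormalization`,
`geometricallyConnected_towards_normal_of_steinFactorization`). (A first version of this file
proved `f_* 𝒪_X = 𝒪_S` as well; it landed concurrently with that file and the duplicate theorems
were removed in its favour.)

## References

* The Stacks Project, Tag 0AY8 (More on Morphisms, Lemma 37.53.6, proof).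
-/

noncomputable section

open CategoryTheory AlgebraicGeometry Limits TopologicalSpace Opposite

universe u

namespace Literature.AlgebraicGeometry.Morphisms

/-- If `X` is reduced and `g : Y ⟶ X` hits every generic point of an irreducible component of
`X`, then pulling back functions along `g` is injective on every open `V ⊆ X`: a section `b`
with `g^*(b) = 0` has `g⁻¹(D(b)) = D(g^* b) = ∅`, so the open `D(b)` contains no generic point,
hence is empty (generic points are dense, Mathlib `genericPoints.closure`), hence `b = 0` as `X`
is reduced. (The Stacks Project, Tag 0AY8, proof: "`f_* 𝒪_X` is torsion free", for
`Y = X_ξ → X`.) [cite: StacksProject, Tag 0AY8 (More on Morphisms, Lemma 37.53.6, proof)] -/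
theorem app_injective_of_genericPoints_subset_range {X Y : Scheme.{u}} [IsReduced X]
    (g : Y ⟶ X) (hg : genericPoints X ⊆ Set.range g.base) (V : X.Opens) :
    Function.Injective (g.app V) := by
  rw [injective_iff_map_eq_zero]
  intro b hb
  rw [← basicOpen_eq_bot_iff]
  have h1 : g ⁻¹ᵁ X.basicOpen b = ⊥ := by
    rw [Scheme.preimage_basicOpen, hb, Scheme.basicOpen_zero]
  by_contra hne
  rw [← Opens.not_nonempty_iff_eq_bot, not_not] at hne
  have hdense : Dense (genericPoints X) := dense_iff_closure_eq.mpr genericPoints.closure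
  obtain ⟨x, hxb, hxg⟩ := hdense.inter_open_nonempty _ (X.basicOpen b).isOpen hne
  obtain ⟨y, rfl⟩ := hg hxg
  have : y ∈ g ⁻¹ᵁ X.basicOpen b := hxb
  simp [h1] at this

variable {X S : Scheme.{u}} (f : X ⟶ S)

/-- `Spec κ(s) → S` pulls every open containing `s` back to everything. [folklore] -/
theorem fromSpecResidueField_preimage_eq_top {s : S} {U : S.Opens} (hs : s ∈ U) :
    S.fromSpecResidueField s ⁻¹ᵁ U = ⊤ := by
  ext t
  simp only [Opens.map_coe, Set.mem_preimage, SetLike.mem_coe, Opens.coe_top, Set.mem_univ,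
    iff_true]
  rw [Scheme.fromSpecResidueField_apply]
  exact hs

/-- The residue map `𝒪_{S,ξ} → κ(ξ)` at the generic point of an integral scheme is bijective
(`𝒪_{S,ξ}` is the function field). [folklore] -/
theorem residue_genericPoint_bijective [IsIntegral S] :
    Function.Bijective (S.residue (genericPoint S)) := by
  refine ⟨fun a b hab ↦ ?_, S.residue_surjective _⟩
  have hm : IsLocalRing.maximalIdeal (S.presheaf.stalk (genericPoint S)) = ⊥ :=
    (IsLocalRing.isField_iff_maximalIdeal_eq).mp (Field.toIsField S.functionField)
  have : a - b ∈ IsLocalRing.maximalIdeal (S.presheaf.stalk (genericPoint S)) := by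
    rw [← IsLocalRing.residue_eq_zero_iff]
    change S.residue (genericPoint S) (a - b) = 0
    rw [map_sub]
    exact sub_eq_zero.mpr hab
  rw [hm, Ideal.mem_bot] at this
  exact sub_eq_zero.mp this

/-- The affine opens contained in an open `U` cover `U`. [folklore] -/
theorem le_iSup_affineOpens_le (U : S.Opens) :
    U ≤ ⨆ V : {V : S.affineOpens // (V : S.Opens) ≤ U}, (V.1 : S.Opens) := by
  intro x hx
  obtain ⟨_, ⟨V, hV, rfl⟩, hxV, hVU⟩ := S.isBasis_affineOpens.exists_subset_of_mem_open hx U.2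
  exact Opens.mem_iSup.mpr ⟨⟨⟨V, hV⟩, hVU⟩, hxV⟩

/-- Naturality of `f^*` on sections, applied to an element. [folklore] -/
theorem app_presheafMap_apply {U V : S.Opens} (i : V ⟶ U) (c : Γ(S, U)) :
    f.app V (S.presheaf.map i.op c) =
      X.presheaf.map ((Opens.map f.base).map i).op (f.app U c) := by
  rw [← CommRingCat.comp_apply, f.naturality]
  rfl

/-- Restriction maps of the structure sheaf only depend on the opens. [folklore] -/
theorem presheaf_map_congr_hom (Y : Scheme.{u}) {U V : Y.Opens} (i j : op U ⟶ op V)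
    (b : Γ(Y, U)) : Y.presheaf.map i b = Y.presheaf.map j b := by
  rw [Subsingleton.elim i j]

end Literature.AlgebraicGeometry.Morphisms

end
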